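import Literature.MathematicalPhysics.QuantumFieldTheory.Balaban1983to89.B8Thm2TorusCoverOfEBlockSymJExists
import Literature.MathematicalPhysics.QuantumFieldTheory.Balaban1983to89.B9CubeLettersInvReadDict

/-!
# [B8] Thm 2 on the torus — the cover interface with the binder in the SUPPLIERS' currencies: (1ₛ), (Eₛ), (Gₛ) = M5.5's site-sector E-block, (Cₛ) ((T) FILE 5-ter)

T. Bałaban, *Spaces of regular gauge field configurations on a lattice and gauge fixing conditions*, Commun. Math. Phys. **99** (1985) 75–102
[`Balaban1985RegularSpaces`, "[B8]"]; *Propagators for lattice gauge theories in a background field*, Commun. Math. Phys. **99** (1985) 389–434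
[`Balaban1985BackgroundPropagators`, "[B9]"]; *Propagators and renormalization transformations for lattice gauge theories. II*, Commun. Math. Phys. **96** (1984)
223–250 [`Balaban1984PropagatorsII`, "[4]"].  statement-level skeleton of published theorems with citation tags; proofs where landed; nothing here is a claim
about the Yang–Mills mass gap

THE PRINT.  [B9] Thm 3.1 (3.42) p. 397 (the four members of the `G′`-block: `G′`, `∇_UG′`, `G′∇*_U`, `Δ_UG′`), Thm 3.2 (3.48) p. 398, (3.25)–(3.27) p. 394–395;
[4] (2.51)–(2.52) p. 232; [B8] Thm 2 p. 83, (1.7) p. 77.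

WHY THIS FILE (cell `lit-balaban`; seat t2s-1 gen 10).  5-bis (`B8Thm2TorusCoverOfEBlockSymJExists.hThm2Cover_of_prop6_eBlockSymData_exists`) displays per shape-member
(1ₛ) ∧ (Eₛ) ∧ (Dₛ), where (Dₛ) lists, for every section `ιB`, the four [4]-(2.51) block majorants `hGs`, `hDl μ`, `hDr ν`, `hT₀`.  The first three ARE READINGS of
ONE statement in M5.5's own endpoint currency — the site-sector (3.42) E-block of the `G′(·; parSymY)` kernel family over the background class,
`EBlock (kernelFamilySInv i B cfg (GpY i (parSymY i)) (parSymY i)) K_G δ₀ U₁` for every reading with `cfg U₁ = bgY i U₀` (p33 FILE 9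
`B9Cor36GpCoverBindersUnitary.eBlock_GpY_of_cubeData_unitary`'s conclusion, verbatim shape) — by D1's dictionary
(`B9CubeLettersInvReadDict.hasMajorant_conj_G_of_eBlockInv ∕ _gradF_mul_G_ ∕ _G_mul_gradB_`: entries 0, 1, 2 of (3.42), constants `M₂Σ‖b_j‖·K_G`, weights `ℓ², ℓ, ℓ`,
SAME rate), read at the one-point family, with the derivative-letter unit `η⁻¹ = |c_f|` in print's units (`ofReal_etaS_inv`).  THIS FILE makes that replacement:
the binder becomes (1ₛ) ∧ (Eₛ) ∧ (Gₛ) ∧ (Cₛ) — (Gₛ) M5.5's E-block statement, (Cₛ) M5.6's (3.48) majorant for every section (p33 FILE 10's shape) — every displayed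
member-level hypothesis now in the exact currency of its supplier of record.

WHAT THIS FILE PROVES (THEOREMS; 0 `def`, 0 `def … : Prop`, 0 sorry; standard axioms).
* §1 `ofReal_etaS_inv` (`(η : ℂ)⁻¹ = |c_f|` in print's units), ★★ `symData_of_eBlockS` ((Gₛ) at `U` ⟹ for every section: `hGs ∧ (∀ μ, hDl μ) ∧ (∀ ν, hDr ν)` with
  `A = A₁ = A₂ = M₂Σ‖b_j‖K_G`, rate `δ₀`, unit `|c_f|`).
* §2 ★★ `symBinder_of_gBinder` (5c ∕ 5-bis's binder [(1ₛ) ∧ (Eₛ) ∧ (Dₛ)] from [(1ₛ) ∧ (Eₛ) ∧ (Gₛ) ∧ (Cₛ)], member by member).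
* §3 ★★★★★ `hThm2Cover_of_prop6_eBlockSymG_exists` — 5-bis §2's interface with the binder [(1ₛ) ∧ (Eₛ) ∧ (Gₛ) ∧ (Cₛ)] (`d + 1 = 3`, `N = 2`; (J) and the walk
  geometry discharged as in 5-bis; `A = A₁ = A₂ := M₂Σ‖b_j‖K_G` in the junction's constants).

HONEST SCOPE ∕ NOT CLAIMED.  (1ₛ), (Eₛ) (M5.7), (Gₛ) (M5.5), (Cₛ) (M5.6) and the numeric windows stay DISPLAYED — suppliers: p33 ∕ p38 lineages, from cube data above
thresholds; nothing here inhabits them.  `stub_PV3A` NOT discharged; no summit ∕ node statement proved; nothing continuum ∕ ℝ⁴ ∕ OS — the Yang–Mills mass gap is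
NOT proved by any of this (Track A conditional rung).  No `sorry`, no `axiom`, no `… : Prop` fact, no `instance`, no `notation`, no `def`.  NEW file; nothing
landed is modified.  `--supports stmt-QuantumFields-19200` as helper.  Net new unproved facts: 0.

RELATED IN THE TREE, NOT DUPLICATED (searched 2026-08-29: `rg 'symData_of_eBlockS|gBinder|SymG_exists' Literature/` = ∅): 5-bis ∕ 5c ∕ FILE 4 (USED BY NAME), D1
`B9CubeLettersInvReadDict` (USED BY NAME), p33 FILE 13 `B9Thm31GradGpAtKnitLetterOfCubeData` (the same D1 readings feeding the KNIT-letter transfer from cube data —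
a different consumer).
-/

noncomputable section

namespace Literature.MathematicalPhysics.QuantumFieldTheory.Balaban1983to89.B8Thm2TorusCoverOfEBlockSymG

open scoped BigOperators
open Node00 B6KLevelCensusIndexV1
open B7Prop1Explicit renaming Site → LSite
open B7Prop1Explicit (e)
open B7Prop2Explicit (unitaryUnits C0 c2')
open B6GlobalChartV1 (PV blkV1)
open B6Geom246MultiLevelBox (blkOf)
open B6Ineq2142KLevelV1 (β)
open B6RandomWalk (HasMajorant Ineq260 Ineq261 Ineq263 Triangle254 c1_nonneg)
open B9Thm34Ext (toB6)
open B9FromB6 (EBlock)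
open B9CubeLettersInvReadings (kernelFamilyBInv kernelFamilySInv)
open B9CubeLettersInvReadDict (hasMajorant_conj_G_of_eBlockInv hasMajorant_gradF_mul_G_of_eBlockInv hasMajorant_G_mul_gradB_of_eBlockInv)
open B9GeoNormsKLevelV1 (geo9K)
open B9Ineq347 (ScaleTransfer)
open B9Eq352DivFormLetters (conj)
open B9Eq352GradLetters (diffLetter)
open B9Eq3104CutoffCommutators (DPDsY)
open B9Cor36GpCoverBindersUnitary (etaS_eq_kGeo_eta_of_cf)
open B8Thm2TorusCoverOfEBlockSymJExists (hThm2Cover_of_prop6_eBlockSymData_exists)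
open B12Ineq417Flat (shiftCfg)
open B8Ineq132 (InAk)
open B8Thm2TorusLettersPerOfKnit (bgY)
open B9B8AveragingJunction (parKnitY)
open B9Eq316AveragingTransposeZd (betaTau alphaQ)
open B7Prop2SpecialUnitary (specialUnitaryUnits)
open B8Thm2TorusAt (Thm2TorusAt)
open T4TermwiseTorus (IsPeriodic)
open scoped Matrix Matrix.Norms.L2Operator

variable {d ℓ : ℕ} {hd : 1 ≤ d + 1} {hL : Odd (ℓ + 1) ∧ 1 < ℓ + 1} {b₀ b₁ : ℝ} {N : ℕ}

/-! ## §1  (Gₛ) ⟹ the three (3.42) block majorants of (Dₛ), for every section -/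

section Member

/-- in print's units `c_f = L^k`: the derivative letters' unit `η⁻¹` IS `|c_f|` (as a complex scalar). [cite: Balaban1984PropagatorsII, (2.1) p.224, bookkeeping] -/
theorem ofReal_etaS_inv (i : KIdx d ℓ hd hL b₀ b₁) (hcf : i.cf = (((ℓ + 1 : ℕ) : ℝ)) ^ i.k) : ((etaS i : ℝ) : ℂ)⁻¹ = ((|i.cf| : ℝ) : ℂ) := by
  rw [etaS_eq_kGeo_eta_of_cf i hcf, show (kGeo i).eta = |i.cf|⁻¹ from rfl, Complex.ofReal_inv, inv_inv]

/-- ★★ **(Gₛ) AT ONE READING ⟹ (3.42)'s ENTRIES 0, 1, 2 AS [4]-(2.51) BLOCK MAJORANTS, FOR EVERY SECTION** (D1's dictionary; the derivative unit `η⁻¹ = |c_f|`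
in print's units): from `EBlock (kernelFamilySInv i B cfg (GpY i (parSymY i)) (parSymY i)) K_G δ₀ U₁` with `cfg U₁ = U`:
`conj b(η²G′(U; parSymY)) ≺ (M₂Σ‖b_j‖K_G)ℓ²e^{−δ₀d}`, `conj b(∂_{U,μ})·conj b(η²G′_S) ≺ (M₂Σ‖b_j‖K_G)ℓe^{−δ₀d}`, `conj b(η²G′_S)·conj b(∂*_{U,ν}) ≺ (M₂Σ‖b_j‖K_G)ℓe^{−δ₀d}`.
[cite: Balaban1985BackgroundPropagators, Thm 3.1 (3.42) p.397; Balaban1984PropagatorsII, (2.51)–(2.52) p.232] -/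
theorem symData_of_eBlockS (i : KIdx d ℓ hd hL b₀ b₁) [Fintype (geo9K i).Site] (hcf : i.cf = (((ℓ + 1 : ℕ) : ℝ)) ^ i.k) {Rg : ℝ} {Hg : Prop}
    {ι : Type} [Fintype ι] [DecidableEq ι] (b : Module.Basis ι ℝ (Matrix (Fin N) (Fin N) ℂ)) {M₂ : ℝ} (hM₂ : 0 ≤ M₂)
    (hrepr : ∀ (v : (Matrix (Fin N) (Fin N) ℂ)) (j : ι), |b.repr v j| ≤ M₂ * ‖v‖)
    {KG δ₀ : ℝ} (hKG : 0 ≤ KG) {B : B9.Backgrounds} (cfg : B.Cfg → CfgY (Matrix (Fin N) (Fin N) ℂ) i) (U₁ : B.Cfg) (U : CfgY (Matrix (Fin N) (Fin N) ℂ) i) (hU : cfg U₁ = U)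
    (hE : EBlock (kernelFamilySInv i B cfg (GpY i (parSymY i)) (parSymY i)) KG δ₀ U₁)
    (ιB : BlkY i → IBondY i) (hι : ∀ s, β i.hN i.D i.hk (ιB s) = s) :
    HasMajorant (g := toB6 (geo9K i) Rg Hg) (fun p : SiteY i × ι => ιB (blkOf i.D.toDomains p.1))
        (conj b ((etaS i ^ 2) • (GpY i (parSymY i) U).restrictScalars ℝ))
        (fun a a' => M₂ * (∑ j, ‖b j‖) * KG * (geo9K i).len a ^ 2 * Real.exp (-(δ₀ * (geo9K i).dist a a'))) ∧
      (∀ μ : Fin (d + 1), HasMajorant (g := toB6 (geo9K i) Rg Hg) (fun p : SiteY i × ι => ιB (blkOf i.D.toDomains p.1))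
        (conj b (diffLetter (shiftY i) (UboxY i U) ((|i.cf| : ℝ) : ℂ) (Sum.inl μ)) *
          conj b ((etaS i ^ 2) • (GpY i (parSymY i) U).restrictScalars ℝ))
        (fun a a' => M₂ * (∑ j, ‖b j‖) * KG * (geo9K i).len a * Real.exp (-(δ₀ * (geo9K i).dist a a')))) ∧
      (∀ ν : Fin (d + 1), HasMajorant (g := toB6 (geo9K i) Rg Hg) (fun p : SiteY i × ι => ιB (blkOf i.D.toDomains p.1))
        (conj b ((etaS i ^ 2) • (GpY i (parSymY i) U).restrictScalars ℝ) *
          conj b (diffLetter (shiftY i) (UboxY i U) ((|i.cf| : ℝ) : ℂ) (Sum.inr ν)))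
        (fun a a' => M₂ * (∑ j, ‖b j‖) * KG * (geo9K i).len a * Real.exp (-(δ₀ * (geo9K i).dist a a')))) := by
  have hη := (ofReal_etaS_inv i hcf).symm
  have hG : ∀ Λ, ((etaS i ^ 2) • (GpY i (parSymY i) U).restrictScalars ℝ) Λ = (etaS i ^ 2) • GpY i (parSymY i) (cfg U₁) Λ := fun Λ => by
    rw [hU]; rfl
  have hUc : UboxY i U = UboxY i (cfg U₁) := by rw [hU]
  refine ⟨?_, fun μ => ?_, fun ν => ?_⟩
  · exact hasMajorant_conj_G_of_eBlockInv i b cfg (GpY i (parSymY i)) (parSymY i) (Rr := Rg) (Hp := Hg) hE hKG ιB hι hM₂ hrepr rfl _ hG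
  · have h := hasMajorant_gradF_mul_G_of_eBlockInv i b cfg (GpY i (parSymY i)) (parSymY i) (Rr := Rg) (Hp := Hg) hE hKG ιB hι hM₂ hrepr rfl hUc _ hG μ
    rw [hη]; exact h
  · have h := hasMajorant_G_mul_gradB_of_eBlockInv i b cfg (GpY i (parSymY i)) (parSymY i) (Rr := Rg) (Hp := Hg) hE hKG ιB hι hM₂ hrepr rfl hUc _ hG ν
    rw [hη]; exact h

end Member

/-! ## §2  The binder [(1ₛ) ∧ (Eₛ) ∧ (Dₛ)] from [(1ₛ) ∧ (Eₛ) ∧ (Gₛ) ∧ (Cₛ)] -/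

section Binder

variable [instF : ∀ i : KIdx d ℓ hd hL 1 1, Fintype (geo9K i).Site]

/-- ★★ **5c ∕ 5-bis's BINDER FROM THE SUPPLIERS'-CURRENCY BINDER**: per shape-member, (Gₛ) (M5.5's E-block of the `G′(·; parSymY)` kernel family at `bgY i U₀`,
constant `K_G`, rate `δ₀`) and (Cₛ) (M5.6's (3.48) majorant for every section, constant `K_T`, rate `δ₀`) give (Dₛ) with `A = A₁ = A₂ = M₂Σ‖b_j‖K_G` (§1, print's
units from `c_f = L^{m′+1}`, `k = m′ + 1`). [cite: Balaban1985BackgroundPropagators, Thm 3.1 (3.42) p.397, Thm 3.2 (3.48) p.398; Balaban1985RegularSpaces, Thm 2 p.83, (1.7) p.77] -/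
theorem symBinder_of_gBinder {a' K' m K : ℕ} {η aT : ℝ} {Hg : Prop} {δE BE : ℝ}
    {ι : Type} [Fintype ι] [DecidableEq ι] (b : Module.Basis ι ℝ (Matrix (Fin N) (Fin N) ℂ)) {M₂ : ℝ} (hM₂ : 0 ≤ M₂)
    (hrepr : ∀ (v : (Matrix (Fin N) (Fin N) ℂ)) (j : ι), |b.repr v j| ≤ M₂ * ‖v‖)
    {KG KT δ₀ : ℝ} (hKG : 0 ≤ KG) {A A₁ A₂ : ℝ} (hAe : A = M₂ * (∑ j, ‖b j‖) * KG) (hA₁e : A₁ = M₂ * (∑ j, ‖b j‖) * KG)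
    (hA₂e : A₂ = M₂ * (∑ j, ‖b j‖) * KG)
    (hΔG : letI : CStarAlgebra (Matrix (Fin N) (Fin N) ℂ) := {}
      ∀ (i : KIdx d ℓ hd hL 1 1) (m' : ℕ), 1 ≤ m' → m' ≤ K' → i.k = m' + 1 → (∀ x, i.D.lev x = m') → i.Mh = (ℓ + 1) ^ a' →
        i.cf = (((ℓ + 1 : ℕ) : ℝ)) ^ (m' + 1) →
        (∀ ι : IBondY i, i.w ι = i.cf ^ 2 * (((((ℓ + 1 : ℕ) : ℝ)) ^ (ι.1.1 : ℕ)) ^ (d + 1) * (1 / (((ℓ + 1 : ℕ) : ℝ)) ^ (ι.1.1 : ℕ)) ^ 2)) →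
        (PV d ℓ i.m i.K hd hL).sitesPerDir 0 = (PV d ℓ m K hd hL).sitesPerDir 0 →
        ∀ (α₀ : ℝ) (U₀ : LSite (d + 1) → Fin (d + 1) → (Matrix (Fin N) (Fin N) ℂ)ˣ),
        (∀ x κ, U₀ x κ ∈ B7Prop2Explicit.unitaryUnits (Matrix (Fin N) (Fin N) ℂ)) →
        IsPeriodic ((PV d ℓ m K hd hL).sitesPerDir 0) U₀ → 0 < α₀ → α₀ ≤ aT →
        InAk (ℓ + 1) m' η α₀ (fun _ => (Set.univ : Set (LSite (d + 1)))) U₀ →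
        IsUnit (deltaAY i (parSymY i) (parBY i) (GpY i (parSymY i)) (bgY i U₀)) ∧
          (∀ (B : B9.Backgrounds) (cfg : B.Cfg → CfgY (Matrix (Fin N) (Fin N) ℂ) i) (par : BondParY (Matrix (Fin N) (Fin N) ℂ) i) (U₁ : B.Cfg),
            cfg U₁ = bgY i U₀ →
            EBlock (kernelFamilyBInv i B cfg (GAY i (parSymY i) (parBY i) (GpY i (parSymY i))) par) BE δE U₁) ∧
        (∀ (B : B9.Backgrounds) (cfg : B.Cfg → CfgY (Matrix (Fin N) (Fin N) ℂ) i) (U₁ : B.Cfg), cfg U₁ = (bgY i U₀) →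
            EBlock (kernelFamilySInv i B cfg (GpY i (parSymY i)) (parSymY i)) KG δ₀ U₁) ∧
          (∀ ιB : BlkY i → IBondY i, (∀ s, β i.hN i.D i.hk (ιB s) = s) →
            HasMajorant (g := toB6 (geo9K i) 1 Hg) (fun q : BlkY i × ι => ιB q.1)
              (conj b ((etaS i ^ 2 * etaS i ^ 2)⁻¹ • (XinvY i (parSymY i) (GpY i (parSymY i)) (bgY i U₀)).restrictScalars ℝ))
              (fun a a' => KT * ((geo9K i).len a ^ 4)⁻¹ * Real.exp (-(δ₀ * (geo9K i).dist a a'))))) :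
    letI : CStarAlgebra (Matrix (Fin N) (Fin N) ℂ) := {}
    ∀ (i : KIdx d ℓ hd hL 1 1) (m' : ℕ), 1 ≤ m' → m' ≤ K' → i.k = m' + 1 → (∀ x, i.D.lev x = m') → i.Mh = (ℓ + 1) ^ a' →
      i.cf = (((ℓ + 1 : ℕ) : ℝ)) ^ (m' + 1) →
      (∀ ι : IBondY i, i.w ι = i.cf ^ 2 * (((((ℓ + 1 : ℕ) : ℝ)) ^ (ι.1.1 : ℕ)) ^ (d + 1) * (1 / (((ℓ + 1 : ℕ) : ℝ)) ^ (ι.1.1 : ℕ)) ^ 2)) →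
      (PV d ℓ i.m i.K hd hL).sitesPerDir 0 = (PV d ℓ m K hd hL).sitesPerDir 0 →
      ∀ (α₀ : ℝ) (U₀ : LSite (d + 1) → Fin (d + 1) → (Matrix (Fin N) (Fin N) ℂ)ˣ),
      (∀ x κ, U₀ x κ ∈ B7Prop2Explicit.unitaryUnits (Matrix (Fin N) (Fin N) ℂ)) →
      IsPeriodic ((PV d ℓ m K hd hL).sitesPerDir 0) U₀ → 0 < α₀ → α₀ ≤ aT →
      InAk (ℓ + 1) m' η α₀ (fun _ => (Set.univ : Set (LSite (d + 1)))) U₀ →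
      IsUnit (deltaAY i (parSymY i) (parBY i) (GpY i (parSymY i)) (bgY i U₀)) ∧
        (∀ (B : B9.Backgrounds) (cfg : B.Cfg → CfgY (Matrix (Fin N) (Fin N) ℂ) i) (par : BondParY (Matrix (Fin N) (Fin N) ℂ) i) (U₁ : B.Cfg),
          cfg U₁ = bgY i U₀ →
          EBlock (kernelFamilyBInv i B cfg (GAY i (parSymY i) (parBY i) (GpY i (parSymY i))) par) BE δE U₁) ∧
      (∀ ιB : BlkY i → IBondY i, (∀ s, β i.hN i.D i.hk (ιB s) = s) →
            HasMajorant (g := toB6 (geo9K i) 1 Hg) (fun p : SiteY i × ι => ιB (blkOf i.D.toDomains p.1))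
                (conj b ((etaS i ^ 2) • (GpY i (parSymY i) (bgY i U₀)).restrictScalars ℝ))
                (fun a a' => A * (geo9K i).len a ^ 2 * Real.exp (-(δ₀ * (geo9K i).dist a a'))) ∧
              (∀ μ : Fin (d + 1), HasMajorant (g := toB6 (geo9K i) 1 Hg) (fun p : SiteY i × ι => ιB (blkOf i.D.toDomains p.1))
                (conj b (diffLetter (shiftY i) (UboxY i (bgY i U₀)) ((|i.cf| : ℝ) : ℂ) (Sum.inl μ)) *
                  conj b ((etaS i ^ 2) • (GpY i (parSymY i) (bgY i U₀)).restrictScalars ℝ))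
                (fun a a' => A₁ * (geo9K i).len a * Real.exp (-(δ₀ * (geo9K i).dist a a')))) ∧
              (∀ ν : Fin (d + 1), HasMajorant (g := toB6 (geo9K i) 1 Hg) (fun p : SiteY i × ι => ιB (blkOf i.D.toDomains p.1))
                (conj b ((etaS i ^ 2) • (GpY i (parSymY i) (bgY i U₀)).restrictScalars ℝ) *
                  conj b (diffLetter (shiftY i) (UboxY i (bgY i U₀)) ((|i.cf| : ℝ) : ℂ) (Sum.inr ν)))
                (fun a a' => A₂ * (geo9K i).len a * Real.exp (-(δ₀ * (geo9K i).dist a a')))) ∧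
              HasMajorant (g := toB6 (geo9K i) 1 Hg) (fun q : BlkY i × ι => ιB q.1)
                (conj b ((etaS i ^ 2 * etaS i ^ 2)⁻¹ • (XinvY i (parSymY i) (GpY i (parSymY i)) (bgY i U₀)).restrictScalars ℝ))
                (fun a a' => KT * ((geo9K i).len a ^ 4)⁻¹ * Real.exp (-(δ₀ * (geo9K i).dist a a')))) := by
  intro i m' hm1 hmK hk hD hMh hcf hw hPV α₀ U₀ hU₀ hperI hα0 hαT hIn
  obtain ⟨h1, hE, hG, hC⟩ := hΔG i m' hm1 hmK hk hD hMh hcf hw hPV α₀ U₀ hU₀ hperI hα0 hαT hIn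
  refine ⟨h1, hE, fun ιB hι => ?_⟩
  have hcf' : i.cf = (((ℓ + 1 : ℕ) : ℝ)) ^ i.k := by rw [hk]; exact hcf
  let Bpt : B9.Backgrounds :=
    { Cfg := Unit, one := (), mul := fun _ _ => (), Reg335 := fun _ _ _ => True, Reg336 := fun _ _ _ => True,
      Cplx337 := fun _ _ _ => True, Cplx338 := fun _ _ _ => True }
  obtain ⟨hGs, hDl, hDr⟩ := symData_of_eBlockS i hcf' b hM₂ hrepr hKG (B := Bpt) (fun _ => bgY i U₀) () (bgY i U₀) rfl (hG Bpt _ () rfl) ιB hι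
  subst hAe hA₁e hA₂e
  exact ⟨hGs, hDl, hDr, hC ιB hι⟩

end Binder

/-! ## §3 ★★★★★ The interface of record with the binder in the suppliers' currencies (`d + 1 = 3`, `SU(2)`) -/

section Cover

open B8Thm2T3FamilyBinder (P_eq_PV)
open T3ContinuumYM3Torus (T3Family)
open T3SectALandauChart (eta eta_pos)

variable {hd₃ : 1 ≤ 2 + 1}
variable [instF : ∀ i : KIdx 2 ℓ hd₃ hL 1 1, Fintype (geo9K i).Site] [instD : ∀ i : KIdx 2 ℓ hd₃ hL 1 1, DecidableEq (geo9K i).Site]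

/-- ★★★★★ **THE TORUS THM 2 INTERFACE OF RECORD — BINDER AT `parSymY` IN THE SUPPLIERS' CURRENCIES, (J) AND WALK GEOMETRY DISCHARGED** (`d + 1 = 3`, `N = 2`):
5-bis's `hThm2Cover_of_prop6_eBlockSymData_exists` with the per-shape-member binder [(1ₛ) `IsUnit Δ_a(bgY i U₀; parSymY)` ∧ (Eₛ) `EBlock (kernelFamilyBInv i B cfg (GAY i
(parSymY i) (parBY i) (GpY i (parSymY i))) par) B_E δ_E U₁` ∧ (Gₛ) `EBlock (kernelFamilySInv i B cfg (GpY i (parSymY i)) (parSymY i)) K_G δ₀ U₁` (every reading with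
`cfg U₁ = bgY i U₀`; M5.5's endpoint currency) ∧ (Cₛ) `∀ ιB section, conj b((η²η²)⁻¹•X(bgY i U₀; parSymY)⁻¹) ≺ K_T(ℓ⁴)⁻¹e^{−δ₀d}` (M5.6's)], the junction's constants read
at `A = A₁ = A₂ = M₂Σ‖b_j‖K_G`.  Displayed: those four member statements and numeric windows only.  HONEST SCOPE: nothing here inhabits them; `stub_PV3A` NOT
discharged; no summit ∕ node statement proved; nothing continuum ∕ ℝ⁴ ∕ OS — the Yang–Mills mass gap is NOT proved by any of this.
[cite: Balaban1985RegularSpaces, Thm 2 p.83, (1.29) p.81, (1.33)–(1.39) pp.82–83, (1.7) p.77, (1.58)–(1.60) pp.86–87; Balaban1985BackgroundPropagators, p.408 l.30–34, Thm 3.1 (3.42) p.397, Thm 3.2 (3.48) p.398, (3.25)–(3.27) p.394–395, (3.49) p.399, Thm 3.3 p.399, (3.101) p.414, (3.106) p.414, Thm 3.11 p.416; Balaban1984PropagatorsII, (2.50)–(2.55) p.232, Lemma 2.1 (2.60)–(2.63) p.234; Balaban1985Averaging, (52)–(53) pp.26–27; Balaban1985UV3, (1)–(3) p.256] -/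
theorem hThm2Cover_of_prop6_eBlockSymG_exists (hℓ : 4 ≤ ℓ)
    (τ : (Matrix (Fin 2) (Fin 2) ℂ) →ₗ[ℂ] ℂ) (hτ : ∀ a, τ a = Matrix.trace a) (hτt : ∀ a b, τ (a * b) = τ (b * a))
    {Cτ : ℝ} (hCτ : ∀ x y : (Matrix (Fin 2) (Fin 2) ℂ), |(τ (star x * y)).re| ≤ Cτ * ‖x‖ * ‖y‖)
    {M : ℝ} (hM1 : 1 ≤ M) {δE α : ℝ} (hδE : 0 < δE) (hαE0 : 0 < α) (hα1 : α < 1)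
    {len : LSite (2 + 1) → ℝ}
    {ι : Type} [Fintype ι] [DecidableEq ι] (b : Module.Basis ι ℝ (Matrix (Fin 2) (Fin 2) ℂ)) {M₂ : ℝ} (hM₂ : 0 ≤ M₂)
    (hrepr : ∀ (v : (Matrix (Fin 2) (Fin 2) ℂ)) (j : ι), |b.repr v j| ≤ M₂ * ‖v‖)
    (Rr : ℝ) (Hp Hg : Prop)
    {δ₀ αg δc δb αb βb δ δ₁ δ₂ δ₃ αst α' αC δ₅ α₅ β₅ δB αB βB ρ δW₁ αW₁ δW₂ αW₂ : ℝ}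
    (hδ₀ : 0 ≤ δ₀) (hαg1 : αg ≤ 1) (pαg : 0 < αg * δ₀) (hαδg : 0 ≤ (1 - αg) * δ₀) (hδc : 0 ≤ δc) (pαb : 0 < αb * δb) (pβb : 0 < βb * δb) (hαb : 0 ≤ αb)
    (hβb : 0 ≤ βb) (hδb : 0 ≤ δb) (hrb : δc + (αb + βb) * δb ≤ (1 - αg) * δ₀) (hδ : δ ≤ (1 - αg) * δ₀) (hδ₁ : δ₁ = (1 - α') * ((1 - αst) * δ))
    (hδ₂ : δ₂ = (1 - α') * ((1 - αst) * δ₁)) (hδ₃ : δ₃ = (1 - α') * ((1 - αst) * δ₂)) (pαst : 0 < αst * δ) (pαst₁ : 0 < αst * δ₁) (pαst₂ : 0 < αst * δ₂)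
    (hα'0 : 0 ≤ α') (hα'1 : α' ≤ 1) (hδ' : 0 ≤ (1 - αst) * δ) (hδ'₂ : 0 ≤ (1 - αst) * δ₁) (hδ'₃ : 0 ≤ (1 - αst) * δ₂) (p₁ : 0 < α' * ((1 - αst) * δ))
    (p₂ : 0 < α' * ((1 - αst) * δ₁)) (p₃ : 0 < α' * ((1 - αst) * δ₂)) (hδ₃0 : 0 ≤ δ₃) (hαC0 : 0 ≤ αC) (hαC1 : αC ≤ 1) (pαC : 0 < αC * δ₃)
    (hαδ₄ : 0 ≤ (1 - αC) * δ₃) (pα₅ : 0 < α₅ * δ₅) (pβ₅ : 0 < β₅ * δ₅) (hα₅ : 0 ≤ α₅) (hβ₅ : 0 ≤ β₅) (hδ₅ : 0 ≤ δ₅)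
    (hr₅ : δc + 2 * (α₅ + β₅) * δ₅ ≤ (1 - αC) * δ₃) (pαB : 0 < αB * δB) (pβB : 0 < βB * δB) (hρ : 0 ≤ ρ) (hαB : 0 ≤ αB) (hβB : 0 ≤ βB) (hδB : 0 ≤ δB)
    (hrB : ρ + (2 * αB + βB) * δB ≤ δc) (pαW₁ : 0 < αW₁ * δW₁) (pαW₂ : 0 < αW₂ * δW₂) (hsplit : αW₁ * δW₁ + αW₂ * δW₂ ≤ ρ) :
    letI : CStarAlgebra (Matrix (Fin 2) (Fin 2) ℂ) := {}
    ∃ d' dg db d₁ d₂ d₃ d₄ d₅ dB dW A₀ : ℕ, ∀ a' : ℕ, A₀ ≤ a' → ∀ BE : ℝ, 0 < BE →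
    ∀ aT : ℝ, 0 < aT → aT ≤ alphaQ (2 + 1) (ℓ + 1) / ((ℓ + 1 : ℕ) : ℝ) ^ 2 → C0 (2 + 1) * aT ≤ 1 / 3 → 2 * aT ≤ c2' (2 + 1) (ℓ + 1) →
      2 * ((48 * (((2 : ℕ) : ℝ) + 1) + 14 * ((2 : ℕ) : ℝ) * M + (32 * (((2 : ℕ) : ℝ) + 2) ^ 2 +
        12 * (((2 : ℕ) : ℝ) + 1) ^ 2 * (13344 * (((2 : ℕ) : ℝ) + 1) * (((2 : ℕ) : ℝ) + 2) ^ 2 * (((2 : ℕ) : ℝ) + 5) * (((ℓ + 1 : ℕ) : ℝ)) ^ (2 + 4)) *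
          (Cτ * betaTau τ))) * aT) * (2 * (BE * B6.c1 d' δE (1 - α) * (((ℓ + 1 : ℕ) : ℝ)) ^ 4)) ≤ 1 →
    ∀ {α₀' : ℝ} (hα₀ : 0 < α₀') (hα₀3 : C0 (2 + 1) * α₀' ≤ 1 / 3) (hα₀2 : 2 * α₀' ≤ c2' (2 + 1) (ℓ + 1))
    (hslack : aT * (((ℓ + 1 : ℕ) : ℝ)) ^ (2 * 1) < α₀')
    {KG KT : ℝ} (hKG : 0 ≤ KG) (hK : 0 ≤ KT) {A A₁ A₂ : ℝ} (hAe : A = M₂ * (∑ j, ‖b j‖) * KG) (hA₁e : A₁ = M₂ * (∑ j, ‖b j‖) * KG)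
    (hA₂e : A₂ = M₂ * (∑ j, ‖b j‖) * KG)
    {θE AK : ℝ} (hθE : θE = 32 * (((2 : ℕ) : ℝ) + 1) ^ 2 * α₀' * (M₂ * ∑ j, ‖b j‖))
    (hAK : AK = A * B6.c1 dg δ₀ αg * (1 - θE * A * B6.c1 dg δ₀ αg)⁻¹) (hsmallg : θE * A * B6.c1 dg δ₀ αg < 1)
    {θF : ℝ} (hθF : θF = (2 * (8 * (((2 : ℕ) : ℝ) + 1) ^ 2 * α₀') * (M₂ * ∑ j, ‖b j‖)) * (M₂ * ∑ j, ‖b j‖) * (A * A * 1 * B6.c1 d₁ ((1 - αst) * δ) α') +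
          (M₂ * ∑ j, ‖b j‖) * (M₂ * ∑ j, ‖b j‖) * ((A + AK) * (AK * (θE * A) * 1 * B6.c1 d₁ ((1 - αst) * δ) α') * 1 * B6.c1 d₂ ((1 - αst) * δ₁) α') +
          (M₂ * ∑ j, ‖b j‖) * ((2 * (8 * (((2 : ℕ) : ℝ) + 1) ^ 2 * α₀') * (M₂ * ∑ j, ‖b j‖))) * (AK * AK * 1 * B6.c1 d₁ ((1 - αst) * δ) α'))
    (hsmall : θF * KT * 1 * B6.c1 d₃ ((1 - αst) * δ₂) α' * B6.c1 d₄ δ₃ αC < 1)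
    {KK : ℝ} (hKK : KK = KT * B6.c1 d₄ δ₃ αC * (1 - θF * KT * 1 * B6.c1 d₃ ((1 - αst) * δ₂) α' * B6.c1 d₄ δ₃ αC)⁻¹)
    {κQ θQ BX θX BY θY B₁ θC κJ : ℝ} (hκQ : κQ = M₂ * ∑ j, ‖b j‖) (hθQ : θQ = 2 * (8 * (((2 : ℕ) : ℝ) + 1) ^ 2 * α₀') * (M₂ * ∑ j, ‖b j‖))
    (hBX : BX = A₁ * (1 + B6.c1 dg δ₀ αg * (θE * A * B6.c1 dg δ₀ αg * (1 - θE * A * B6.c1 dg δ₀ αg)⁻¹)))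
    (hθX : θX = BX * θE * A * 1 * B6.c1 db δb βb) (hBY : BY = (((2 : ℕ) : ℝ) + 1) * A₂) (hθY : θY = AK * θE * BY * 1 * B6.c1 db δb βb)
    (hB₁ : B₁ = max KT KK) (hθC : θC = B₁ * B₁ * θF * 1 * B6.c1 d₅ δ₅ β₅ ^ 2)
    (hκJ : κJ = 1 ^ 4 * B6.c1 dB δB βB ^ 2 *
      (κQ * κQ * θX * B₁ * BY + κQ * θQ * BX * B₁ * BY + κQ * κQ * BX * θC * BY + θQ * κQ * BX * B₁ * BY + κQ * κQ * BX * B₁ * θY)),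
    2 * (((((2 : ℕ) : ℝ) + 3) * (BE * B6.c1 d' δE (1 - α) * (((ℓ + 1 : ℕ) : ℝ)) ^ 4)) * (κJ * (M₂ * ∑ j, ‖b j‖) * 1 * B6.c1 dW δW₂ αW₂)) ≤ 1 →
    ∃ a₀' : ℝ, 0 < a₀' ∧ ∃ k₀ : ℕ, ∃ cα : ℝ, 0 < cα ∧
    ∀ cL : ℝ, 0 < cL → cL * (((ℓ + 1 : ℕ) : ℝ)) ^ 2 < a₀' →
      cL ≤ min (1 / 16) (min aT (min aT (1 / (2 * (2 * (2 * (BE * B6.c1 d' δE (1 - α) * (((ℓ + 1 : ℕ) : ℝ)) ^ 4))) * (14 * ((2 + 1 - 1 : ℕ) : ℝ)) * M + 1)))) →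
      cL ≤ cα →
    ∃ B₁' B₂ c₁ : ℝ, 0 < B₁' ∧ 0 < B₂ ∧ 0 < c₁ ∧
    ∀ F : T3Family, F.L = ℓ + 1 → ∀ (n K : ℕ), n < K →
      (∀ (i : KIdx 2 ℓ hd₃ hL 1 1) (m' : ℕ), 1 ≤ m' → m' ≤ K - n → i.k = m' + 1 → (∀ x, i.D.lev x = m') → i.Mh = (ℓ + 1) ^ a' →
        i.cf = (((ℓ + 1 : ℕ) : ℝ)) ^ (m' + 1) →
        (∀ ι : IBondY i, i.w ι = i.cf ^ 2 * (((((ℓ + 1 : ℕ) : ℝ)) ^ (ι.1.1 : ℕ)) ^ (2 + 1) * (1 / (((ℓ + 1 : ℕ) : ℝ)) ^ (ι.1.1 : ℕ)) ^ 2)) →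
        (PV 2 ℓ i.m i.K hd₃ hL).sitesPerDir 0 = (PV 2 ℓ (F.m + k₀) K hd₃ hL).sitesPerDir 0 →
        ∀ (α₀ : ℝ) (U₀ : LSite (2 + 1) → Fin (2 + 1) → (Matrix (Fin 2) (Fin 2) ℂ)ˣ),
        (∀ x κ, U₀ x κ ∈ B7Prop2Explicit.unitaryUnits (Matrix (Fin 2) (Fin 2) ℂ)) →
        IsPeriodic ((PV 2 ℓ (F.m + k₀) K hd₃ hL).sitesPerDir 0) U₀ → 0 < α₀ → α₀ ≤ aT →
        InAk (ℓ + 1) m' (eta F n K) α₀ (fun _ => (Set.univ : Set (LSite (2 + 1)))) U₀ →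
          IsUnit (deltaAY i (parSymY i) (parBY i) (GpY i (parSymY i)) (bgY i U₀)) ∧
          (∀ (B : B9.Backgrounds) (cfg : B.Cfg → CfgY (Matrix (Fin 2) (Fin 2) ℂ) i) (par : BondParY (Matrix (Fin 2) (Fin 2) ℂ) i) (U₁ : B.Cfg),
            cfg U₁ = bgY i U₀ →
            EBlock (kernelFamilyBInv i B cfg (GAY i (parSymY i) (parBY i) (GpY i (parSymY i))) par) BE δE U₁) ∧
          (∀ (B : B9.Backgrounds) (cfg : B.Cfg → CfgY (Matrix (Fin 2) (Fin 2) ℂ) i) (U₁ : B.Cfg), cfg U₁ = (bgY i U₀) →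
              EBlock (kernelFamilySInv i B cfg (GpY i (parSymY i)) (parSymY i)) KG δ₀ U₁) ∧
            (∀ ιB : BlkY i → IBondY i, (∀ s, β i.hN i.D i.hk (ιB s) = s) →
              HasMajorant (g := toB6 (geo9K i) 1 Hg) (fun q : BlkY i × ι => ιB q.1)
                (conj b ((etaS i ^ 2 * etaS i ^ 2)⁻¹ • (XinvY i (parSymY i) (GpY i (parSymY i)) (bgY i U₀)).restrictScalars ℝ))
                (fun a a' => KT * ((geo9K i).len a ^ 4)⁻¹ * Real.exp (-(δ₀ * (geo9K i).dist a a'))))) →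
      (((F.P K).sitesPerDir 0 : ℕ) : ℤ) ∣ (((PV 2 ℓ (F.m + k₀) K hd₃ hL).sitesPerDir 0 : ℕ) : ℤ) ∧
      (((ℓ + 1 : ℕ) : ℤ)) ^ (K - n) ∣ (((F.P K).sitesPerDir 0 : ℕ) : ℤ) ∧
      Thm2TorusAt (ℓ + 1) (K - n) ((((PV 2 ℓ (F.m + k₀) K hd₃ hL).sitesPerDir 0 : ℕ) : ℤ)) (eta F n K) 0 B₁' B₂ c₁ len
        (specialUnitaryUnits (Fin 2)) (fun _ => True) := by
  letI : CStarAlgebra (Matrix (Fin 2) (Fin 2) ℂ) := {}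
  obtain ⟨d', dg, db, d₁, d₂, d₃, d₄, d₅, dB, dW, A₀, H⟩ := hThm2Cover_of_prop6_eBlockSymData_exists (hd₃ := hd₃) (hL := hL) (len := len) hℓ τ hτ hτt hCτ hM1
    hδE hαE0 hα1 b hM₂ hrepr Rr Hp Hg hδ₀ hαg1 pαg hαδg hδc pαb pβb hαb hβb hδb hrb hδ hδ₁ hδ₂ hδ₃ pαst pαst₁ pαst₂ hα'0 hα'1 hδ' hδ'₂ hδ'₃ p₁ p₂ p₃ hδ₃0 hαC0 hαC1 pαC hαδ₄ pα₅ pβ₅ hα₅ hβ₅ hδ₅ hr₅ pαB pβB hρ hαB hβB hδB hrB pαW₁ pαW₂ hsplit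
  refine ⟨d', dg, db, d₁, d₂, d₃, d₄, d₅, dB, dW, A₀, fun a' ha' BE hBE aT haT haTQ haT3 haT2 hεB => ?_⟩
  intro α₀' hα₀ hα₀3 hα₀2 hslack KG KT hKG hK A A₁' A₂' hAe hA₁e hA₂e θE AK hθE hAK hsmallg θF hθF hsmall KK hKK κQ θQ BX θX BY θY B₁ θC κJ hκQ hθQ hBX
    hθX hBY hθY hB₁ hθC hκJ hθ
  have hSb : 0 ≤ ∑ j, ‖b j‖ := Finset.sum_nonneg fun _ _ => norm_nonneg _
  have hA0 : 0 ≤ M₂ * (∑ j, ‖b j‖) * KG := mul_nonneg (mul_nonneg hM₂ hSb) hKG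
  obtain ⟨a₀', ha₀', k₀, cα, hcα, HH⟩ := H a' ha' BE hBE aT haT haTQ haT3 haT2 hεB hα₀ hα₀3 hα₀2 hslack (hAe ▸ hA0) (hA₁e ▸ hA0) (hA₂e ▸ hA0) hK
    hθE hAK hsmallg hθF hsmall hKK hκQ hθQ hBX hθX hBY hθY hB₁ hθC hκJ hθ
  refine ⟨a₀', ha₀', k₀, cα, hcα, fun cL hcL hαe hcLP hcLα => ?_⟩
  obtain ⟨B₁', B₂, c₁, hB₁', hB₂, hc₁, HT⟩ := HH cL hcL hαe hcLP hcLα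
  exact ⟨B₁', B₂, c₁, hB₁', hB₂, hc₁, fun F hF n K hnK hΔ =>
    HT F hF n K hnK (symBinder_of_gBinder (d := 2) (hd := hd₃) (instF := instF) b hM₂ hrepr hKG hAe hA₁e hA₂e hΔ)⟩

end Cover

end Literature.MathematicalPhysics.QuantumFieldTheory.Balaban1983to89.B8Thm2TorusCoverOfEBlockSymG

end
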